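import Summits.BirchSwinnertonDyer.Rank1Residual.X11a.PartnerSplitType
import HarnessLib

/-!
# Class X11a, route (3d): the BOOKING SHAPES — `BSD(E,p)` from a `p`-congruent partner CLOSED at `p`,
# with C1 as the Kraus–Oesterlé congruence list (cell `b2b-bsdres`, unit `b2b-bsdres-x11a`, gen 24)

HONEST FRAMING (run/shared/lean/b2b/bsd-rank1-residual/, verbatim in every file): the goal of the
cell is to DELETE the COMBINATION-SHAPED residual classes of the Birch–Swinnerton-Dyer formula for
ALL analytic-rank `≤ 1` elliptic curves over `ℚ` — "full BSD formula for every rank `≤ 1` curve in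
class `C`" assembled STRICTLY from published theorems — so that the rank-`≤ 1` remainder becomes
exactly the CONSTRUCTION-SHAPED classes, which are TYPED (missing-input `Prop`s), NOT attempted.
This is not "finishing BSD". Research route; NO CLAIM BEYOND STATED CLASSES. Theorems only; no
definition, no new named fact; nothing booked by this file; no label change.

WHAT. The census `HOME/b2b-bsdres-x11a/g24/TRIVIAL-PARTNER-CENSUS.md` lists 13 non-split
non-surjective-leaf cells @5 with a 5-congruent partner `A` of trivial 5-primary arithmetic, C1
certified as the Kraus–Oesterlé congruence list (kit j123512 / j123628), the partner being closed at
5 either by Miller (N_A < 5000; `X11a.bsdp_of_trivialPartner_of_conductor_lt`) or by the lane's own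
closure of `(A, 5)`. THIS FILE states the second case in exactly the shape a booking cites — ONE
kernel theorem whose non-published binders are the finite certificates the lane holds:

* `bsdp_of_bsdp_partner_of_congruences` — `BSD(A,p) ⟹ BSD(E,p)` for `(E,p) ∈ X11a`, `p ≥ 5`, along
  the Kraus–Oesterlé congruence list `hcong`, from a rank-`0` partner `A` good ordinary and
  non-anomalous at `p` with `p ∤ ∏c_ℓ(A)` and `ord_p(L(A,1)/Ω_A) = 0` (published binders: modularity,
  K–O Prop. 4, BCS 1.1.2 (a) [partner], Greenberg 4.1, the period ratio, EPW Cor. 5.1.4, SW13 ×2,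
  GZK, Greenberg–Stevens);
* `bsdp_of_bsdp_partner_of_congruences_of_not_split` — the same with the non-anomalous certificate
  replaced by "`E` non-split at `p`" (`PartnerSplitType.not_dvd_reductionPointCount_of_equiv_of_not_split`;
  one more published binder, the Tate uniformisation A41).

References: [KrausOesterle1992] Prop. 4; [EmertonPollackWeston2006] Cor. 5.1.4; [Miller2011LMS]
Def. 1.1; HOME/b2b-bsdres-x11a/REPORT-g24.md.
-/

noncomputable section

open scoped Classical

open WeierstrassCurve Literature.NumberTheory.EllipticCurves
  Literature.NumberTheory.EllipticCurves.ModularForms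
  Literature.NumberTheory.EllipticCurves.Rank1Residual
  Literature.NumberTheory.EllipticCurves.Rank1Residual.Typed
  Literature.NumberTheory.EllipticCurves.SteinWuthrich2013
  Literature.NumberTheory.EllipticCurves.GreenbergVatsal2000
  Literature.NumberTheory.EllipticCurves.EmertonPollackWeston2006

set_option autoImplicit false

namespace Summit.BirchSwinnertonDyer.Rank1Residual.X11a

variable (W A : WeierstrassCurve ℚ) [W.IsElliptic] [W.IsGloballyMinimal] [A.IsElliptic]
  [A.IsGloballyMinimal] (p : ℕ) [Fact p.Prime]

/-- **Booking shape of route (3d): `BSD(A,p) ⟹ BSD(E,p)` along a Kraus–Oesterlé congruence list.**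
`(E,p) ∈ X11a`, `p ≥ 5`; the partner `A` is good ordinary and non-anomalous at `p`, of analytic
rank `0`, with `p ∤ ∏c_ℓ(A)`, `ord_p(L(A,1)/Ω_A) = 0` and `BSD(A,p)` (whence `Ш(A)[p^∞] = 0`); C1 is
the finite list `hcong` of trace congruences below the Kraus–Oesterlé bound (`hKO`). Composition of
`bsdp_of_trivialPartner_of_bsdp_partner` with `KrausOesterle1992.torsionIso_of_congruences`.
[cite: KrausOesterle1992, Prop. 4] [cite: EmertonPollackWeston2006, Cor. 5.1.4 (arXiv:math/0404484 p. 30)]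
[cite: Miller2011LMS, Def. 1.1] -/
theorem bsdp_of_bsdp_partner_of_congruences (hNf : exists_isNewformOf)
    (hKO : KrausOesterle1992.prop4_torsionIso_of_congruences)
    (hBCS : burungale_castella_skinner_charIdeal_eq_padicLFunction)
    (hGr : greenberg_charValue_rankZero) (hΩ : realPeriodRat_eq_unit_mul_plusPeriod)
    (hEPW : cor514_transfer_of_goodOrdinary)
    (hJs : thm61_splitMultiplicative) (hJn : thm61_nonsplitMultiplicative)
    (hGZK : rank_eq_analyticRank_of_analyticRank_le_one)
    (hGS : greenberg_stevens (W := W) (p := p))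
    (hX : ClassX11a W p) (h5 : 5 ≤ p)
    (hgoodA : A.HasGoodReductionAtPrime p) (hordA : ¬ (p : ℤ) ∣ A.frobeniusTrace p)
    (hna : ¬ p ∣ A.reductionPointCount p) (htam : ¬ p ∣ A.tamagawaProduct)
    (hL : ∃ q : ℚ, q ≠ 0 ∧ A.entireLFunction 1 / (A.realPeriodRat : ℂ) = (q : ℂ) ∧ padicValRat p q = 0)
    (hrA : A.analyticRank = 0) (hbsdA : BSDp A p)
    (hcong : ∀ (ℓ : ℕ) [Fact ℓ.Prime],
      6 * ℓ < KrausOesterle1992.gammaZeroIndex (KrausOesterle1992.modulus W A) →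
      (padicValNat ℓ (W.conductorNorm ℤ * A.conductorNorm ℤ) = 0 →
          (p : ℤ) ∣ W.frobeniusTrace ℓ - A.frobeniusTrace ℓ) ∧
        (padicValNat ℓ (W.conductorNorm ℤ * A.conductorNorm ℤ) = 1 →
          (p : ℤ) ∣ W.frobeniusTrace ℓ * A.frobeniusTrace ℓ - (ℓ + 1))) :
    BSDp W p :=
  bsdp_of_trivialPartner_of_bsdp_partner W A p hNf hBCS hGr hΩ hEPW hJs hJn hGZK hGS hX h5 hgoodA hordA
    hna htam hL hrA hbsdA (KrausOesterle1992.torsionIso_of_congruences hKO W A p hX.irr hcong)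

/-- **The same at a NON-SPLIT pair, the non-anomalous certificate discharged** by
`PartnerSplitType.not_dvd_reductionPointCount_of_equiv_of_not_split` (binder A41, the Tate
uniformisation of `X2/TateLineDecomposition`). This is the shape of the nine `5S4` closures of the
gen-24 census (all non-split at 5; partners closed at 5 by Cha 2005 + a Heegner-index certificate).
[cite: KrausOesterle1992, Prop. 4] [cite: EmertonPollackWeston2006, Cor. 5.1.4 (arXiv:math/0404484 p. 30)]
[cite: SilvermanATAEC1994, Ch. V Lemma 5.2 (c), Thm. 5.3, Cor. 5.4] -/
theorem bsdp_of_bsdp_partner_of_congruences_of_not_split (hNf : exists_isNewformOf)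
    (hKO : KrausOesterle1992.prop4_torsionIso_of_congruences)
    (hT : Silverman1994_thmV53_corV54_tateUniformisation.{0})
    (hBCS : burungale_castella_skinner_charIdeal_eq_padicLFunction)
    (hGr : greenberg_charValue_rankZero) (hΩ : realPeriodRat_eq_unit_mul_plusPeriod)
    (hEPW : cor514_transfer_of_goodOrdinary)
    (hJs : thm61_splitMultiplicative) (hJn : thm61_nonsplitMultiplicative)
    (hGZK : rank_eq_analyticRank_of_analyticRank_le_one)
    (hGS : greenberg_stevens (W := W) (p := p))
    (hX : ClassX11a W p) (h5 : 5 ≤ p) (hns : ¬ W.HasSplitMultiplicativeReductionAtPrime p)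
    (hgoodA : A.HasGoodReductionAtPrime p) (hordA : ¬ (p : ℤ) ∣ A.frobeniusTrace p)
    (htam : ¬ p ∣ A.tamagawaProduct)
    (hL : ∃ q : ℚ, q ≠ 0 ∧ A.entireLFunction 1 / (A.realPeriodRat : ℂ) = (q : ℂ) ∧ padicValRat p q = 0)
    (hrA : A.analyticRank = 0) (hbsdA : BSDp A p)
    (hcong : ∀ (ℓ : ℕ) [Fact ℓ.Prime],
      6 * ℓ < KrausOesterle1992.gammaZeroIndex (KrausOesterle1992.modulus W A) →
      (padicValNat ℓ (W.conductorNorm ℤ * A.conductorNorm ℤ) = 0 →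
          (p : ℤ) ∣ W.frobeniusTrace ℓ - A.frobeniusTrace ℓ) ∧
        (padicValNat ℓ (W.conductorNorm ℤ * A.conductorNorm ℤ) = 1 →
          (p : ℤ) ∣ W.frobeniusTrace ℓ * A.frobeniusTrace ℓ - (ℓ + 1))) :
    BSDp W p := by
  obtain ⟨e, he⟩ := KrausOesterle1992.torsionIso_of_congruences hKO W A p hX.irr hcong
  have hp2 : p ≠ 2 := by omega
  have hna : ¬ p ∣ A.reductionPointCount p :=
    PartnerSplitType.not_dvd_reductionPointCount_of_equiv_of_not_split hT hp2 hX.mult hns hgoodA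
      hordA e he
  exact bsdp_of_trivialPartner_of_bsdp_partner W A p hNf hBCS hGr hΩ hEPW hJs hJn hGZK hGS hX h5 hgoodA
    hordA hna htam hL hrA hbsdA ⟨e, he⟩

end Summit.BirchSwinnertonDyer.Rank1Residual.X11a

end
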